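import Summits.HodgeConjecture.HodgeConjecture.Theorems.K2E3WittConeContraction
import Summits.HodgeConjecture.HodgeConjecture.Theorems.K2E3BlockRadicalRayLevelsAnyForm
import HarnessLib

/-!
# The contraction data of the Witt cone FOR ANY WITT TYPE `(r, m)` (crux H413, row 13a, organ J1 — the `hJ`-free edition)

★ `K2E3WittConeContraction` assembles the cone binders of ★ `Representation.isSupercuspidal_of_subsingleton_coinvariants_of_cartan_pi` for the
QUASI-SPLIT Witt forms `wittFormOn e Han = Φ_N` (`m ≤ 1`), in the Borel-triple currency `(borelTriple σ _ hJ).N`.  For EVEN `N` the local unitary group at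
a non-split place may be the NON-quasi-split form: Witt type `m = 2` (a `2`-dimensional anisotropic kernel `Han`), for which no `hJ : wittFormOn e Han = Φ_N`
exists.  This file repeats §2–§3 for ANY `m`, over ★ `K2E3BlockRadicalRayLevelsAnyForm` (levels `a_α^{-j}(K_γ ∩ N ∩ U_{c_α})a_α^{j}` with `N = unipotentU σ J`
the upper unitriangular subgroup — for `J = Φ_N` this is `(borelTriple σ J hJ).N` by `rfl`, so the statements below specialise to those of the
quasi-split file on the nose):

* §2 `wittRayLevel_mono` (`hmono`), `conj_mem_wittRayLevel` (`hcontr`), `conj_mem_wittRayLevel_of_commute` (`hpres`), `exists_mem_wittRayLevel` (`hexh`, on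
  `(standardParabolicTriple σ e Han (univ.erase α)).N`), `exists_wittRayLevel_subset` (`hsmall`) — for the Witt cocharacters
  `a_α = wittCocharacter σ hσ e Han α ϖ` of ★ D₁ and the maximal-parabolic labellings `c_α = wittBlockOn e (univ.erase α)` in a STANDARD indexing `e`.
* §3 **`isSupercuspidal_of_subsingleton_coinvariants_of_wittCartan`** (any `m`): a smooth representation of `U(σ, wittFormOn e Han)(K)` (`K` a
  non-archimedean local field, `σ` a continuous involution, `|σ ϖ| = |ϖ| < 1`) whose Jacquet modules along the `r` maximal standard parabolics vanish is
  supercuspidal, GIVEN the Cartan decomposition over the Witt cone `U = K₀ · {∏_α a_α(ϖ)^{n_α}} · K₀ · Z(U)` for SOME compact subgroup `K₀` (hypothesis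
  `hcartan`; `K₀` a parameter — for `m = 2` the good maximal compact is the stabiliser of a maximal lattice, not always `U ∩ GL_N(𝒪)`; for
  `K₀ = U ∩ GL_N(𝒪)` feed ★ `AnyRank.isCompact_comap_glInt σ hσc` — that specialisation is NOT restated here: the gate's dedup identifies it with the
  quasi-split ★ `K2E3WittConeContraction.isSupercuspidal_of_subsingleton_coinvariants_of_wittCartan`).

HONEST LABEL: structure lemmas + an implication; HC_CM is proved only modulo the 7 printed citations (2 remaining named inputs: hLiu418 =
stmt-HodgeConjecture-24832, h413 = stmt-HodgeConjecture-24833) until rung 0 closes.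

References: W. Casselman (1995), Prop. 1.4.4, Thm. 5.3.1; I. N. Bernstein, A. V. Zelevinsky (1976) §3.18–3.21, (1977) §1.9, §2.1; A. Borel (1991) §23.
-/

set_option autoImplicit false
set_option linter.dupNamespace false

open scoped MatrixGroups Pointwise Topology
open ValuativeRel Matrix

namespace Summit.HodgeConjecture.HodgeConjecture.Cruxes.H413.K2E3WittConeContractionAnyKernel

open Literature.NumberTheory.Automorphic Literature.NumberTheory.Automorphic.UnitaryGroup
open K2E3LocalUnitaryWitt K2E3WittStandardIndexing K2E3WittCoweightRatios K2E3BlockRadicalRayLevelsAnyForm K2E3WittConeContraction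

/-! ## §2 The block ray levels of a Witt cocharacter: `hmono`, `hcontr`, `hpres`, `hexh`, `hsmall` -/

section Ray

variable {K : Type*} [Field K] [ValuativeRel K] (σ : K →+* K) (hσ : ∀ a, σ (σ a) = a) {N r m : ℕ} (e : WittIndex r m ≃ Fin N)
  (hstd : ∀ x, (e x).val = Sum.elim (fun i : Fin r => i.val) (Sum.elim (fun u : Fin m => r + u.val) (fun j : Fin r => r + m + j.val)) x)
  (Han : Matrix (Fin m) (Fin m) K)
  (ϖ : Kˣ) (hϖ1 : valuation K (ϖ : K) ≤ 1) (hσϖ : valuation K (σ ϖ) = valuation K (ϖ : K))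

include hstd hϖ1 hσϖ in
/-- **`hmono`: the block ray levels of `a_α(ϖ)` increase**, `a_α^{-j}(K_γ ∩ N ∩ U_{c_α})a_α^{j} ≤ a_α^{-(j+1)}(…)a_α^{j+1}`
(coweight ratios `≤ 1` along positions). [cite: BernsteinZelevinsky1976, §3.18–3.21] [cite: Casselman1995, Prop. 1.4.4] -/
theorem wittRayLevel_mono {γ : ValueGroupWithZero K} (hγ : γ < 1) (α : Fin r) (j : ℤ) :
    ((congruenceGL N γ).comap (unitaryGroupOfForm σ (wittFormOn e Han)).subtype ⊓ unipotentU σ (wittFormOn e Han) ⊓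
        (unipotentRadicalGL K (wittBlockOn e (Finset.univ.erase α))).comap (unitaryGroupOfForm σ (wittFormOn e Han)).subtype).map
        (MulAut.conj (wittCocharacter σ hσ e Han α ϖ ^ (-j))).toMonoidHom ≤
      ((congruenceGL N γ).comap (unitaryGroupOfForm σ (wittFormOn e Han)).subtype ⊓ unipotentU σ (wittFormOn e Han) ⊓
        (unipotentRadicalGL K (wittBlockOn e (Finset.univ.erase α))).comap (unitaryGroupOfForm σ (wittFormOn e Han)).subtype).map
        (MulAut.conj (wittCocharacter σ hσ e Han α ϖ ^ (-(j + 1)))).toMonoidHom :=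
  blockRayLevel_mono σ (wittFormOn e Han) (wittBlockOn e (Finset.univ.erase α)) (monotone_wittBlockOn_of_std e hstd _) hγ _ _
    (coe_wittCocharacter_eq_glDiagonal σ e hσ Han ϖ α) (fun i j hij => valuation_wittCoweight_ratio_le_one_of_lt σ α ϖ hϖ1 hσϖ e hstd i j hij) j

/-- **`hcontr`: `a_α(ϖ)` contracts its block ray levels** (re-bracketing). [cite: BernsteinZelevinsky1976, §3.18–3.21] -/
theorem conj_mem_wittRayLevel {γ : ValueGroupWithZero K} (α : Fin r) (j : ℤ) {u : ↥(unitaryGroupOfForm σ (wittFormOn e Han))}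
    (hu : u ∈ ((congruenceGL N γ).comap (unitaryGroupOfForm σ (wittFormOn e Han)).subtype ⊓ unipotentU σ (wittFormOn e Han) ⊓
        (unipotentRadicalGL K (wittBlockOn e (Finset.univ.erase α))).comap (unitaryGroupOfForm σ (wittFormOn e Han)).subtype).map
        (MulAut.conj (wittCocharacter σ hσ e Han α ϖ ^ (-(j + 1)))).toMonoidHom) :
    wittCocharacter σ hσ e Han α ϖ * u * (wittCocharacter σ hσ e Han α ϖ)⁻¹ ∈
      ((congruenceGL N γ).comap (unitaryGroupOfForm σ (wittFormOn e Han)).subtype ⊓ unipotentU σ (wittFormOn e Han) ⊓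
        (unipotentRadicalGL K (wittBlockOn e (Finset.univ.erase α))).comap (unitaryGroupOfForm σ (wittFormOn e Han)).subtype).map
        (MulAut.conj (wittCocharacter σ hσ e Han α ϖ ^ (-j))).toMonoidHom :=
  conj_mem_blockRayLevel σ (wittFormOn e Han) (wittBlockOn e (Finset.univ.erase α)) _ j hu

include hstd hϖ1 hσϖ in
/-- **`hpres`: `a_β(ϖ)` preserves the block ray levels of `a_α(ϖ)`** (they commute; the coweight ratios of `β` are `≤ 1` along positions).
[cite: Casselman1995, Prop. 1.4.4; Thm. 5.3.1] -/
theorem conj_mem_wittRayLevel_of_commute {γ : ValueGroupWithZero K} (hγ : γ < 1) (α β : Fin r) (j : ℤ)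
    {u : ↥(unitaryGroupOfForm σ (wittFormOn e Han))}
    (hu : u ∈ ((congruenceGL N γ).comap (unitaryGroupOfForm σ (wittFormOn e Han)).subtype ⊓ unipotentU σ (wittFormOn e Han) ⊓
        (unipotentRadicalGL K (wittBlockOn e (Finset.univ.erase α))).comap (unitaryGroupOfForm σ (wittFormOn e Han)).subtype).map
        (MulAut.conj (wittCocharacter σ hσ e Han α ϖ ^ (-j))).toMonoidHom) :
    wittCocharacter σ hσ e Han β ϖ * u * (wittCocharacter σ hσ e Han β ϖ)⁻¹ ∈
      ((congruenceGL N γ).comap (unitaryGroupOfForm σ (wittFormOn e Han)).subtype ⊓ unipotentU σ (wittFormOn e Han) ⊓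
        (unipotentRadicalGL K (wittBlockOn e (Finset.univ.erase α))).comap (unitaryGroupOfForm σ (wittFormOn e Han)).subtype).map
        (MulAut.conj (wittCocharacter σ hσ e Han α ϖ ^ (-j))).toMonoidHom :=
  conj_mem_blockRayLevel_of_ratio_le_one σ (wittFormOn e Han) (wittBlockOn e (Finset.univ.erase α)) (monotone_wittBlockOn_of_std e hstd _) hγ _ _
    (commute_wittCocharacter σ e hσ Han α β ϖ ϖ) _ (coe_wittCocharacter_eq_glDiagonal σ e hσ Han ϖ β)
    (fun i j hij => valuation_wittCoweight_ratio_le_one_of_lt σ β ϖ hϖ1 hσϖ e hstd i j hij) j hu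

end Ray

section RayTop

variable {K : Type*} [Field K] [ValuativeRel K] [TopologicalSpace K] [IsNonarchimedeanLocalField K]
  (σ : K →+* K) (hσ : ∀ a, σ (σ a) = a) {N r m : ℕ} (e : WittIndex r m ≃ Fin N)
  (hstd : ∀ x, (e x).val = Sum.elim (fun i : Fin r => i.val) (Sum.elim (fun u : Fin m => r + u.val) (fun j : Fin r => r + m + j.val)) x)
  (Han : Matrix (Fin m) (Fin m) K)
  (ϖ : Kˣ) (hϖ : valuation K (ϖ : K) < 1) (hσϖ : valuation K (σ ϖ) = valuation K (ϖ : K))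

include hstd hϖ hσϖ in
/-- **`hexh`: the block ray levels of `a_α(ϖ)` exhaust the radical `N_α = (standardParabolicTriple σ e Han (univ.erase α)).N`** of the maximal
parabolic of `α` (`0 < |ϖ| < 1`; across the break the coweight contracts by `|ϖ|`; `N_α ≤ N`). [cite: BernsteinZelevinsky1977, §1.9]
[cite: Casselman1995, proof of Thm. 5.3.1] -/
theorem exists_mem_wittRayLevel {γ : ValueGroupWithZero K} (hγ0 : γ ≠ 0) (hγ : γ < 1) (α : Fin r)
    {u : ↥(unitaryGroupOfForm σ (wittFormOn e Han))} (hu : u ∈ (standardParabolicTriple σ e Han (Finset.univ.erase α)).N) :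
    ∃ j : ℤ, u ∈ ((congruenceGL N γ).comap (unitaryGroupOfForm σ (wittFormOn e Han)).subtype ⊓ unipotentU σ (wittFormOn e Han) ⊓
        (unipotentRadicalGL K (wittBlockOn e (Finset.univ.erase α))).comap (unitaryGroupOfForm σ (wittFormOn e Han)).subtype).map
        (MulAut.conj (wittCocharacter σ hσ e Han α ϖ ^ (-j))).toMonoidHom :=
  exists_mem_blockRayLevel σ (wittFormOn e Han) (wittBlockOn e (Finset.univ.erase α)) (monotone_wittBlockOn_of_std e hstd _)
    ((Valuation.ne_zero_iff _).2 (Units.ne_zero ϖ)) hϖ hγ0 hγ _ _ (coe_wittCocharacter_eq_glDiagonal σ e hσ Han ϖ α)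
    (fun i j _ hc => valuation_wittCoweight_ratio_le_of_label_lt σ α ϖ hϖ.le hσϖ e i j hc)
    (wittRadical_le_unipotentU σ e hstd (wittFormOn e Han) _ hu) hu

include hstd hϖ hσϖ in
/-- **`hsmall`: the block ray levels of `a_α(ϖ)` shrink to `1`**: every neighbourhood of `1` in `U` contains one of them.
[cite: BernsteinZelevinsky1976, §3.18–3.21] [cite: Casselman1995, Prop. 1.4.4] -/
theorem exists_wittRayLevel_subset {γ : ValueGroupWithZero K} (hγ0 : γ ≠ 0) (hγ : γ < 1) (α : Fin r)
    {O : Set ↥(unitaryGroupOfForm σ (wittFormOn e Han))} (hO : O ∈ 𝓝 (1 : ↥(unitaryGroupOfForm σ (wittFormOn e Han)))) :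
    ∃ j : ℤ, ((((congruenceGL N γ).comap (unitaryGroupOfForm σ (wittFormOn e Han)).subtype ⊓ unipotentU σ (wittFormOn e Han) ⊓
        (unipotentRadicalGL K (wittBlockOn e (Finset.univ.erase α))).comap (unitaryGroupOfForm σ (wittFormOn e Han)).subtype).map
        (MulAut.conj (wittCocharacter σ hσ e Han α ϖ ^ (-j))).toMonoidHom : Subgroup ↥(unitaryGroupOfForm σ (wittFormOn e Han))) :
          Set ↥(unitaryGroupOfForm σ (wittFormOn e Han))) ⊆ O :=
  exists_blockRayLevel_subset σ (wittFormOn e Han) (wittBlockOn e (Finset.univ.erase α)) (monotone_wittBlockOn_of_std e hstd _)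
    ((Valuation.ne_zero_iff _).2 (Units.ne_zero ϖ)) hϖ hγ0 hγ _ _ (coe_wittCocharacter_eq_glDiagonal σ e hσ Han ϖ α)
    (fun i j _ hc => valuation_wittCoweight_ratio_le_of_label_lt σ α ϖ hϖ.le hσϖ e i j hc) hO

/-! ## §3 Harish-Chandra's criterion over the Witt cone, modulo the Cartan decomposition -/

include hstd hϖ hσϖ in
/-- **HARISH-CHANDRA'S CRITERION ⇐ FOR `U(σ, wittFormOn e Han)(K)` OVER THE WITT CONE, ANY WITT TYPE `(r, m)`** (standard indexing `e`; `K` a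
non-archimedean local field, `σ` a continuous involution with `|σ ϖ| = |ϖ|`, `0 < |ϖ| < 1`; `m = 2` is the non-quasi-split even unitary group).  IF the Cartan decomposition
`U = K₀ · {∏_α a_α(ϖ)^{n_α} : n ∈ ℕ^r} · K₀ · Z(U)` holds for a COMPACT subgroup `K₀` (a parameter; hypothesis `hcartan`), THEN every smooth
representation of `U` whose Jacquet modules along the `r` maximal standard parabolics `P_{univ ∖ {α}}` vanish is supercuspidal: the tree's ★
`Representation.isSupercuspidal_of_subsingleton_coinvariants_of_cartan_pi` fed with §2.
[cite: Casselman1995, Thm. 5.3.1] [cite: BernsteinZelevinsky1976, Thm. 3.21] [cite: HarishChandra1970, Part I §3] -/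
theorem isSupercuspidal_of_subsingleton_coinvariants_of_wittCartan_compact {V : Type*} [AddCommGroup V] [Module ℂ V]
    (ρ : Representation ℂ ↥(unitaryGroupOfForm σ (wittFormOn e Han)) V) (hρ : ρ.IsSmooth)
    (h : ∀ α : Fin r, Subsingleton ((standardParabolicTriple σ e Han (Finset.univ.erase α)).restrict ρ).Coinvariants)
    (K₀ : Subgroup ↥(unitaryGroupOfForm σ (wittFormOn e Han))) (hK₀ : IsCompact (K₀ : Set ↥(unitaryGroupOfForm σ (wittFormOn e Han))))
    (hcartan : ∀ g : ↥(unitaryGroupOfForm σ (wittFormOn e Han)), ∃ k₁ ∈ K₀, ∃ k₂ ∈ K₀, ∃ n : Fin r → ℕ,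
      ∃ z ∈ Subgroup.center ↥(unitaryGroupOfForm σ (wittFormOn e Han)),
        g = k₁ * Finset.univ.noncommProd (fun α => wittCocharacter σ hσ e Han α ϖ ^ n α)
          (fun α _ β _ _ => (commute_wittCocharacter σ e hσ Han α β ϖ ϖ).pow_pow (n α) (n β)) * k₂ * z) :
    ρ.IsSupercuspidal :=
  ρ.isSupercuspidal_of_subsingleton_coinvariants_of_cartan_pi hρ (fun α => standardParabolicTriple σ e Han (Finset.univ.erase α)) h
    (fun α j => ((congruenceGL N (valuation K (ϖ : K))).comap (unitaryGroupOfForm σ (wittFormOn e Han)).subtype ⊓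
        unipotentU σ (wittFormOn e Han) ⊓
        (unipotentRadicalGL K (wittBlockOn e (Finset.univ.erase α))).comap (unitaryGroupOfForm σ (wittFormOn e Han)).subtype).map
        (MulAut.conj (wittCocharacter σ hσ e Han α ϖ ^ (-j))).toMonoidHom)
    (fun α j => wittRayLevel_mono σ hσ e hstd Han ϖ hϖ.le hσϖ hϖ α j)
    (fun α _ hu => exists_mem_wittRayLevel σ hσ e hstd Han ϖ hϖ hσϖ ((Valuation.ne_zero_iff _).2 (Units.ne_zero ϖ)) hϖ α hu)
    (fun α _ hO => exists_wittRayLevel_subset σ hσ e hstd Han ϖ hϖ hσϖ ((Valuation.ne_zero_iff _).2 (Units.ne_zero ϖ)) hϖ α hO)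
    (fun α => wittCocharacter σ hσ e Han α ϖ) (fun α β => commute_wittCocharacter σ e hσ Han α β ϖ ϖ)
    (fun α j _ hu => conj_mem_wittRayLevel σ hσ e Han ϖ α j hu)
    (fun α β j _ hu => conj_mem_wittRayLevel_of_commute σ hσ e hstd Han ϖ hϖ.le hσϖ hϖ α β j hu)
    K₀ hK₀ hcartan

end RayTop

end Summit.HodgeConjecture.HodgeConjecture.Cruxes.H413.K2E3WittConeContractionAnyKernel
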